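import Summits.CriticalPhenomena.PercolationContinuityZ3.Theorems.PercNearOneGluingNoHeavyLowerTailSahiTangentPrincipalBottom
import Literature.Combinatorics.Sahi2008.Percolation

/-!
# `NoHeavyLowerTail` (crux stmt-CriticalPhenomena-4575), Sahi programme: the principal-bottom tangent theorem ON THE CUBE —
# **cylinder bottoms, ARBITRARY increasing tops, every product measure** (supersedes the cylinder-PAIR theorem of gen 48)

Support file (Sahi cell, seat `prim-sahi-p1`, generation 49; `--supports stmt-CriticalPhenomena-4575`).  Pure proof, no definitions, no
`sorry`, standard axioms.  One corollary of `SahiTangent.sahiE_three_coin_principalBottom_ge` (`…SahiTangentPrincipalBottom`, this seat and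
generation) for the Boolean lattice `Set ι` with Sahi's product weight `bernoulliWeight q` (`Literature/Combinatorics/Sahi2008/Percolation`,
an FKG weight by `isFKGMeasure_bernoulliWeight`), whose principal up-sets `principalUp d = {ω | d ⊆ ω}` are the CYLINDER events
"all coordinates (edges) of `d` are open".

THE RESULT (`sahiE_three_coin_cylinderBottom_ge`).  `ι` finite, `q : ι → [0,1]`, `s ∈ [0,1]`; `U, V, W` arbitrary increasing events of the cube
`Set ι` (up-sets, as `Finset`s) and cylinders `{ω | u ⊆ ω} ⊆ U`, `{ω | v ⊆ ω} ⊆ V`, `{ω | w ⊆ ω} ⊆ W`; slots `F_U(ε,ω) = (ε ? χ_U ω : χ_{u ⊆ ω})`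
etc. on `Bool × Set ι` under the coin product `B_s ⊗ bernoulliWeight q`.  Then
`s · E₃^{bernoulliWeight q}(χ_U, χ_V, χ_W) ≤ E₃^{B_s ⊗ bernoulliWeight q}(F_U, F_V, F_W)`.
Reading (percolation, the coin being one more independent edge `e` of probability `s`): for three increasing events `A_l` of a product measure
such that "`A_l` without `e`" is a cylinder event (`A_l ∩ {e closed} = {D_l open}`), `E₃(A_0,A_1,A_2) ≥ P(e open)·E₃(A_0,A_1,A_2 | e open)` — the
contraction inequality (CO) of memo FROM-prim-sahi-p2-gen32-TANGENT for this class; gen 48's `SahiTangentCyl.sahiE_three_coin_cylinders_ge` is the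
sub-case in which the tops `A_l ∩ {e open}` are cylinders too.  For UNIONS of cylinders as bottoms the inequality fails at `|ι| = 4` (gen 47 /
census W161).  Nothing is asserted about Sahi's `C_n`, Kahn's conjecture or the increasing star. [this work]
-/

namespace Summit.CriticalPhenomena.PercolationContinuityZ3.Theorems.SahiTangent

open Finset Literature.Combinatorics.Sahi2008
open Literature.Probability.LatticeModels (principalUp)

noncomputable section

variable {ι : Type*} [Fintype ι] [DecidableEq (Set ι)] [DecidableLE (Set ι)]

/-- **The contraction inequality on a cube: cylinder bottoms, arbitrary increasing tops, every product measure.**  For `q : ι → [0,1]`,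
`s ∈ [0,1]`, up-sets `U, V, W` of `Set ι` containing the cylinders `{ω | u ⊆ ω}`, `{ω | v ⊆ ω}`, `{ω | w ⊆ ω}` respectively:
`s · E₃^{bernoulliWeight q}(χ_U,χ_V,χ_W) ≤ E₃^{B_s ⊗ bernoulliWeight q}(F_U,F_V,F_W)`. [this work] -/
theorem sahiE_three_coin_cylinderBottom_ge (q : ι → unitInterval) {s : ℝ} (hs₀ : 0 ≤ s) (hs₁ : s ≤ 1)
    {U V W : Finset (Set ι)} (hU : IsUpperSet (U : Set (Set ι))) (hV : IsUpperSet (V : Set (Set ι)))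
    (hW : IsUpperSet (W : Set (Set ι))) {u v w : Set ι}
    (huU : principalUp u ⊆ U) (hvV : principalUp v ⊆ V) (hwW : principalUp w ⊆ W) :
    s * sahiE (bernoulliWeight q) 3 ![setInd U, setInd V, setInd W] ≤
      sahiE (fun z : Bool × Set ι => if z.1 then s * bernoulliWeight q z.2 else (1 - s) * bernoulliWeight q z.2) 3
        ![fun z => if z.1 then setInd U z.2 else setInd (principalUp u) z.2,
          fun z => if z.1 then setInd V z.2 else setInd (principalUp v) z.2,
          fun z => if z.1 then setInd W z.2 else setInd (principalUp w) z.2] :=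
  sahiE_three_coin_principalBottom_ge (isFKGMeasure_bernoulliWeight q) hU hV hW huU hvV hwW hs₀ hs₁

end

end Summit.CriticalPhenomena.PercolationContinuityZ3.Theorems.SahiTangent
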